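import Literature.Geometry.Lorentzian.ADMTransitionRigidity
import HarnessLib

/-!
# The asymptotic rotation of the transition between two structures at infinity

Support file (all results proved) for Bartnik's uniqueness theorem for the ADM energy
(`AFEnd.HasADMEnergy.Of_isSameEnd`; Bartnik, CPAM 39 (1986), Cor. 3.2). The hypothesis
structure `TransitionDecay h h' G G' α K R S` records, as plain analysis on a finite-dimensional
real inner product space `E`, what two asymptotically flat structures at infinity of the same end
provide after the reduction of `AsymptoticFlatnessTransition`: metric components `h` (beyond
radius `R` in the `x`-chart) and `h'` (beyond radius `S` in the `y`-chart) with
`h − δ = O₂(r^{−α})`, `h' − δ = O₁(r^{−α})` (one constant `K`), the smooth transition map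
`x = G(y)` with the tensor transformation law `h'(y)(v,w) = h(Gy)(DGv, DGw)`, and the inverse
transition `G'` with its law and `G'(G y) = y`.

The main result `TransitionDecay.exists_rotation` is the rigidity theorem of Bartnik 1986,
Cor. 3.2 (there for weighted Sobolev decay, via harmonic coordinates; here in the pointwise form
and by the elementary argument of Chruściel 1986, §2): there is a linear isometry `O` of `E` with

  `‖DG(y) − O‖ ≤ C‖y‖^{−α}`, `‖D²G(y)‖ ≤ C‖y‖^{−α−1}`, `‖G(y) − Oy‖ ≤ C‖y‖^{1−α}`,
  `‖y‖/4 ≤ ‖G y‖ ≤ 3‖y‖`, `‖DG(y)‖ ≤ 2`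

for all `‖y‖ ≥ S₁`. Steps: `‖DG‖, ‖DG'‖ ≤ 2` (pointwise algebra); linear growth of `G'`, hence
`‖G y‖ ≥ ‖y‖/4`; the Christoffel trick gives `‖D²G‖ ≤ 774 K ‖y‖^{−α−1}`; radial integration
gives the limit `O` of `DG` with rate, `O` is inner-product preserving (limit of the almost
orthogonality of `DG`), and `G − O` grows sublinearly.

## References

* R. Bartnik, *The mass of an asymptotically flat manifold*, CPAM 39 (1986), §3, Cor. 3.2.
* P. T. Chruściel, *Boundary conditions at spatial infinity from a Hamiltonian point of view*,
  in: Topological properties and global structure of space-time (1986), §2.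
-/

noncomputable section

-- instance search on the nested operator spaces `E →L[ℝ] E →L[ℝ] E →L[ℝ] ℝ` is deep
set_option maxSynthPendingDepth 3

open Set Filter Metric ContinuousLinearMap
open scoped Topology RealInnerProductSpace ContDiff

namespace Literature.Geometry.Lorentzian

namespace TransitionRigidity

variable {E : Type*} [NormedAddCommGroup E] [InnerProductSpace ℝ E]

/-- **Two asymptotically flat structures at infinity related by a transition map** (hypothesis
structure). `h`, `h'` are the metric components in the `x`- and `y`-charts, `x = G(y)` the
transition map and `G'` its inverse; `α ∈ (0,1)` the decay order, `K` the decay constant, `R`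
(resp. `S`) the radius in the `x`-chart (resp. `y`-chart) beyond which everything holds, large
enough that `K R^{−α}, K S^{−α} ≤ 1/2`. The fields are: smoothness and symmetry of `h`, decay
`‖h − δ‖ ≤ K r^{−α}`, `‖Dh‖ ≤ K r^{−α−1}`, `‖D²h‖ ≤ K r^{−α−2}` beyond `R`; differentiability of
`G'`, its transformation law and `‖h'(G'x) − δ‖ ≤ 1/2` beyond `R`; smoothness and decay
`‖h' − δ‖ ≤ K r^{−α}`, `‖Dh'‖ ≤ K r^{−α−1}` beyond `S`; smoothness of `G`, `‖G y‖ ≥ R + 1`, the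
law `h'(y)(v,w) = h(Gy)(DG v, DG w)` and `G'(G y) = y` beyond `S`. This is the situation of
Bartnik 1986, §3 (two structures of infinity `Φ`, `Ψ` of the same end, with the transition
`Φ ∘ Ψ⁻¹` defined on `E_{R₁}`), in `C²`/`C¹` pointwise form. [cite: Bartnik1986, §3, Cor. 3.2] -/
structure TransitionDecay (h h' : E → E →L[ℝ] E →L[ℝ] ℝ) (G G' : E → E) (α K R S : ℝ) :
    Prop where
  /-- The decay order is positive. -/
  α_pos : 0 < α
  /-- The decay order is `< 1` (no loss: decay of order `α` implies decay of smaller order). -/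
  α_lt_one : α < 1
  /-- The decay constant is nonnegative. -/
  K_nonneg : 0 ≤ K
  /-- The `x`-radius is at least `1`. -/
  one_le_R : 1 ≤ R
  /-- The `y`-radius is at least `1`. -/
  one_le_S : 1 ≤ S
  /-- Smallness beyond `R`: `K R^{−α} ≤ 1/2`. -/
  small_R : K * R ^ (-α) ≤ 1 / 2
  /-- Smallness beyond `S`: `K S^{−α} ≤ 1/2`. -/
  small_S : K * S ^ (-α) ≤ 1 / 2
  /-- `h` is smooth beyond `R`. -/
  contDiffAt_h : ∀ x, R < ‖x‖ → ContDiffAt ℝ ∞ h x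
  /-- `h` is symmetric. -/
  symm_h : ∀ x v w, h x v w = h x w v
  /-- `‖h − δ‖ ≤ K r^{−α}` beyond `R`. -/
  norm_h_sub_le : ∀ x, R < ‖x‖ → ‖h x - innerSL ℝ‖ ≤ K * ‖x‖ ^ (-α)
  /-- `‖Dh‖ ≤ K r^{−α−1}` beyond `R`. -/
  norm_fderiv_h_le : ∀ x, R < ‖x‖ → ‖fderiv ℝ h x‖ ≤ K * ‖x‖ ^ (-α - 1)
  /-- `‖D²h‖ ≤ K r^{−α−2}` beyond `R`. -/
  norm_fderiv_fderiv_h_le : ∀ x, R < ‖x‖ → ‖fderiv ℝ (fderiv ℝ h) x‖ ≤ K * ‖x‖ ^ (-α - 2)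
  /-- The inverse transition is differentiable beyond `R`. -/
  differentiableAt_G' : ∀ x, R < ‖x‖ → DifferentiableAt ℝ G' x
  /-- The transformation law of the inverse transition beyond `R`. -/
  law' : ∀ x, R < ‖x‖ → ∀ v w, h x v w = h' (G' x) (fderiv ℝ G' x v) (fderiv ℝ G' x w)
  /-- The inverse transition maps `{R < ‖x‖}` to where `h'` is `1/2`-close to `δ`. -/
  small_G' : ∀ x, R < ‖x‖ → ‖h' (G' x) - innerSL ℝ‖ ≤ 1 / 2
  /-- `h'` is smooth beyond `S`. -/
  contDiffAt_h' : ∀ y, S < ‖y‖ → ContDiffAt ℝ ∞ h' y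
  /-- `‖h' − δ‖ ≤ K r^{−α}` beyond `S`. -/
  norm_h'_sub_le : ∀ y, S < ‖y‖ → ‖h' y - innerSL ℝ‖ ≤ K * ‖y‖ ^ (-α)
  /-- `‖Dh'‖ ≤ K r^{−α−1}` beyond `S`. -/
  norm_fderiv_h'_le : ∀ y, S < ‖y‖ → ‖fderiv ℝ h' y‖ ≤ K * ‖y‖ ^ (-α - 1)
  /-- The transition map is smooth beyond `S`. -/
  contDiffAt_G : ∀ y, S < ‖y‖ → ContDiffAt ℝ ∞ G y
  /-- The transition map sends `{S < ‖y‖}` into `{R + 1 ≤ ‖x‖}`. -/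
  far_G : ∀ y, S < ‖y‖ → R + 1 ≤ ‖G y‖
  /-- The tensor transformation law beyond `S`. -/
  law : ∀ y, S < ‖y‖ → ∀ v w, h' y v w = h (G y) (fderiv ℝ G y v) (fderiv ℝ G y w)
  /-- `G'` is a left inverse of `G` beyond `S`. -/
  left_inv : ∀ y, S < ‖y‖ → G' (G y) = y

namespace TransitionDecay

variable {h h' : E → E →L[ℝ] E →L[ℝ] ℝ} {G G' : E → E} {α K R S : ℝ}
  (hd : TransitionDecay h h' G G' α K R S)
include hd

/-- Coercion of naturals into `ℕ∞ω` stays below `∞`. [folklore] -/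
theorem natCast_le_infty (m : ℕ) : (m : ℕ∞ω) ≤ ∞ := by
  have := hd.α_pos
  exact WithTop.coe_le_coe.mpr le_top

/-! ### Smallness of `h − δ`, `h' − δ` far out -/

/-- A decay bound `K r^{−α}` beyond a radius `ρ ≥ 1` with `K ρ^{−α} ≤ 1/2` is at most `1/2`.
[folklore] -/
theorem decay_le_half {ρ : ℝ} (hρ : 1 ≤ ρ) (hsmall : K * ρ ^ (-α) ≤ 1 / 2) {z : E} (hz : ρ < ‖z‖) :
    K * ‖z‖ ^ (-α) ≤ 1 / 2 := by
  have hρ0 : 0 < ρ := by linarith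
  have h1 : ‖z‖ ^ (-α) ≤ ρ ^ (-α) :=
    Real.rpow_le_rpow_of_nonpos hρ0 hz.le (by linarith [hd.α_pos])
  calc K * ‖z‖ ^ (-α) ≤ K * ρ ^ (-α) := mul_le_mul_of_nonneg_left h1 hd.K_nonneg
    _ ≤ 1 / 2 := hsmall

/-- `‖h(x) − δ‖ ≤ 1/2` for `‖x‖ > R`. [folklore] -/
theorem norm_h_sub_le_half {x : E} (hx : R < ‖x‖) : ‖h x - innerSL ℝ‖ ≤ 1 / 2 :=
  (hd.norm_h_sub_le x hx).trans (hd.decay_le_half hd.one_le_R hd.small_R hx)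

/-- `‖h'(y) − δ‖ ≤ 1/2` for `‖y‖ > S`. [folklore] -/
theorem norm_h'_sub_le_half {y : E} (hy : S < ‖y‖) : ‖h' y - innerSL ℝ‖ ≤ 1 / 2 :=
  (hd.norm_h'_sub_le y hy).trans (hd.decay_le_half hd.one_le_S hd.small_S hy)

/-- `G y` lies beyond `R` for `‖y‖ > S`. [folklore] -/
theorem lt_norm_G {y : E} (hy : S < ‖y‖) : R < ‖G y‖ := by
  have := hd.far_G y hy; linarith

/-- `‖h(G y) − δ‖ ≤ 1/2` for `‖y‖ > S`. [folklore] -/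
theorem norm_hG_sub_le_half {y : E} (hy : S < ‖y‖) : ‖h (G y) - innerSL ℝ‖ ≤ 1 / 2 :=
  hd.norm_h_sub_le_half (hd.lt_norm_G hy)

/-! ### First derivatives of the transition maps -/

/-- `‖DG(y)‖ ≤ 2` for `‖y‖ > S`. Bartnik 1986, Cor. 3.2; Chruściel 1986, §2. [cite: Bartnik1986, §3, Cor. 3.2] -/
theorem norm_fderiv_G_le {y : E} (hy : S < ‖y‖) : ‖fderiv ℝ G y‖ ≤ 2 :=
  opNorm_map_le (hd.norm_hG_sub_le_half hy) (hd.norm_h'_sub_le_half hy) (hd.law y hy)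

/-- `‖v‖ ≤ 2‖DG(y) v‖` for `‖y‖ > S`. [folklore] -/
theorem norm_le_two_mul_norm_fderiv_G {y : E} (hy : S < ‖y‖) (v : E) :
    ‖v‖ ≤ 2 * ‖fderiv ℝ G y v‖ :=
  norm_le_two_mul_norm_map (hd.norm_hG_sub_le_half hy) (hd.norm_h'_sub_le_half hy) (hd.law y hy) v

/-- `‖DG'(x)‖ ≤ 2` for `‖x‖ > R`. [folklore] -/
theorem norm_fderiv_G'_le {x : E} (hx : R < ‖x‖) : ‖fderiv ℝ G' x‖ ≤ 2 :=
  opNorm_map_le (hd.small_G' x hx) (hd.norm_h_sub_le_half hx) (hd.law' x hx)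

/-! ### Linear growth and the two-sided comparison `‖G y‖ ≍ ‖y‖` -/

/-- **Linear growth of the inverse transition**: `‖G'(x)‖ ≤ M' + 2‖x‖` for `‖x‖ ≥ R + 1`.
[folklore] -/
theorem exists_norm_G'_le [FiniteDimensional ℝ E] :
    ∃ M' : ℝ, 0 ≤ M' ∧ ∀ x : E, R + 1 ≤ ‖x‖ → ‖G' x‖ ≤ M' + 2 * ‖x‖ := by
  have hR1 : 0 < R + 1 := by linarith [hd.one_le_R]
  obtain ⟨M, hM⟩ := norm_le_of_norm_fderiv_le_rpow (f := G') (α := 0) (C := 2) hR1 zero_lt_one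
    (by norm_num) (fun z hz ↦ hd.differentiableAt_G' z (by linarith))
    (fun z hz ↦ by
      rw [neg_zero, Real.rpow_zero, mul_one]
      exact hd.norm_fderiv_G'_le (by linarith))
  refine ⟨max M 0, le_max_right _ _, fun x hx ↦ ?_⟩
  have := hM x hx
  rw [sub_zero, div_one, Real.rpow_one] at this
  linarith [le_max_left M 0]

/-- **Linear growth of the transition**: `‖G(y)‖ ≤ M + 2‖y‖` for `‖y‖ ≥ S + 1`. [folklore] -/
theorem exists_norm_G_le [FiniteDimensional ℝ E] :
    ∃ M : ℝ, 0 ≤ M ∧ ∀ y : E, S + 1 ≤ ‖y‖ → ‖G y‖ ≤ M + 2 * ‖y‖ := by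
  have hS1 : 0 < S + 1 := by linarith [hd.one_le_S]
  obtain ⟨M, hM⟩ := norm_le_of_norm_fderiv_le_rpow (f := G) (α := 0) (C := 2) hS1 zero_lt_one
    (by norm_num) (fun z hz ↦ ((hd.contDiffAt_G z (by linarith)).differentiableAt (by simp)))
    (fun z hz ↦ by
      rw [neg_zero, Real.rpow_zero, mul_one]
      exact hd.norm_fderiv_G_le (by linarith))
  refine ⟨max M 0, le_max_right _ _, fun y hy ↦ ?_⟩
  have := hM y hy
  rw [sub_zero, div_one, Real.rpow_one] at this
  linarith [le_max_left M 0]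

/-- **`‖G y‖ ≍ ‖y‖`**: there is `S₀ ≥ S + 1` with `‖y‖/4 ≤ ‖G y‖ ≤ 3‖y‖` for `‖y‖ ≥ S₀`
(lower bound from `y = G'(G y)` and the linear growth of `G'`). Bartnik 1986, Cor. 3.2.
[cite: Bartnik1986, §3, Cor. 3.2] -/
theorem exists_norm_G_two_sided [FiniteDimensional ℝ E] :
    ∃ S₀ : ℝ, S + 1 ≤ S₀ ∧ ∀ y : E, S₀ ≤ ‖y‖ → ‖y‖ / 4 ≤ ‖G y‖ ∧ ‖G y‖ ≤ 3 * ‖y‖ := by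
  obtain ⟨M', hM'0, hM'⟩ := hd.exists_norm_G'_le
  obtain ⟨M, hM0, hM⟩ := hd.exists_norm_G_le
  refine ⟨max (S + 1) (max (2 * M') M), le_max_left _ _, fun y hy ↦ ⟨?_, ?_⟩⟩
  · have hyS : S < ‖y‖ := by
      have := le_max_left (S + 1) (max (2 * M') M); linarith
    have h1 := hM' (G y) (hd.far_G y hyS)
    rw [hd.left_inv y hyS] at h1
    have h2 : 2 * M' ≤ ‖y‖ := (le_max_left _ _).trans ((le_max_right _ _).trans hy)
    linarith
  · have h1 := hM y ((le_max_left _ _).trans hy)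
    have h2 : M ≤ ‖y‖ := (le_max_right _ _).trans ((le_max_right _ _).trans hy)
    linarith

/-! ### Second derivatives of the transition map -/

/-- **`‖D²G(y)‖ ≤ 774 K ‖y‖^{−α−1}`** wherever `‖y‖ > S` and `‖G y‖ ≥ ‖y‖/4`: the
differentiated transformation law and the Christoffel trick (`norm_snd_le_of_law`) give
`‖D²G‖ ≤ 6(‖Dh'(y)‖ + 8‖Dh(Gy)‖)`, and `‖Gy‖^{−α−1} ≤ 16‖y‖^{−α−1}`. Bartnik 1986, (3.5)–(3.6),
Cor. 3.2 (`∂²x/∂y² ∈ W^{0,q}_{−1−τ}`). [cite: Bartnik1986, §3, Cor. 3.2] -/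
theorem norm_fderiv_fderiv_G_le [FiniteDimensional ℝ E] {y : E} (hy : S < ‖y‖)
    (hlow : ‖y‖ / 4 ≤ ‖G y‖) :
    ‖fderiv ℝ (fderiv ℝ G) y‖ ≤ 774 * K * ‖y‖ ^ (-α - 1) := by
  have hα := hd.α_pos
  have hα1 := hd.α_lt_one
  have hy0 : 0 < ‖y‖ := by linarith [hd.one_le_S]
  have hGy : R < ‖G y‖ := hd.lt_norm_G hy
  have hG2 : ContDiffAt ℝ 2 G y := (hd.contDiffAt_G y hy).of_le (hd.natCast_le_infty 2)
  -- the differentiated law at `y`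
  have hlaw_ev : ∀ᶠ z in 𝓝 y, ∀ v w, h' z v w = h (G z) (fderiv ℝ G z v) (fderiv ℝ G z w) := by
    filter_upwards [(isOpen_lt continuous_const continuous_norm).mem_nhds hy] with z hz
    exact hd.law z hz
  have hh : DifferentiableAt ℝ h (G y) := (hd.contDiffAt_h _ hGy).differentiableAt (by simp)
  have hh' : DifferentiableAt ℝ h' y := (hd.contDiffAt_h' _ hy).differentiableAt (by simp)
  have hdlaw := fun u v w ↦ fderiv_law_apply hlaw_ev hG2 hh hh' u v w
  have hS : ∀ u v, fderiv ℝ (fderiv ℝ G) y u v = fderiv ℝ (fderiv ℝ G) y v u := fun u v ↦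
    (hG2.isSymmSndFDerivAt (by rw [minSmoothness_of_isRCLikeNormedField])).eq u v
  have hbound := norm_snd_le_of_law (hd.norm_hG_sub_le_half hy) (hd.norm_h'_sub_le_half hy)
    (hd.law y hy) (hd.symm_h (G y)) hS hdlaw
  -- insert the decay of `Dh'` and `Dh`
  have h1 : ‖fderiv ℝ h' y‖ ≤ K * ‖y‖ ^ (-α - 1) := hd.norm_fderiv_h'_le y hy
  have h2 : ‖fderiv ℝ h (G y)‖ ≤ K * (16 * ‖y‖ ^ (-α - 1)) := by
    refine (hd.norm_fderiv_h_le _ hGy).trans (mul_le_mul_of_nonneg_left ?_ hd.K_nonneg)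
    have hq : 0 < ‖y‖ / 4 := by positivity
    calc ‖G y‖ ^ (-α - 1) ≤ (‖y‖ / 4) ^ (-α - 1) :=
          Real.rpow_le_rpow_of_nonpos hq hlow (by linarith)
      _ = ‖y‖ ^ (-α - 1) * (4 : ℝ) ^ (α + 1) := by
          rw [Real.div_rpow hy0.le (by norm_num), div_eq_mul_inv, ← Real.rpow_neg (by norm_num)]
          congr 2; ring
      _ ≤ ‖y‖ ^ (-α - 1) * (4 : ℝ) ^ (2 : ℝ) :=
          mul_le_mul_of_nonneg_left (Real.rpow_le_rpow_of_exponent_le (by norm_num) (by linarith))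
            (by positivity)
      _ = 16 * ‖y‖ ^ (-α - 1) := by norm_num; ring
  calc ‖fderiv ℝ (fderiv ℝ G) y‖ ≤ 6 * (‖fderiv ℝ h' y‖ + 8 * ‖fderiv ℝ h (G y)‖) := hbound
    _ ≤ 6 * (K * ‖y‖ ^ (-α - 1) + 8 * (K * (16 * ‖y‖ ^ (-α - 1)))) := by gcongr
    _ = 774 * K * ‖y‖ ^ (-α - 1) := by ring

/-! ### The asymptotic rotation -/

/-- **Rigidity of the transition between two structures at infinity** (Bartnik 1986, Cor. 3.2;
Chruściel 1986, §2, in pointwise form). Under `TransitionDecay h h' G G' α K R S` on a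
finite-dimensional real inner product space of dimension `≥ 2`, there are a linear isometry `O`
of `E`, a radius `S₁ ≥ S + 1` and a constant `C ≥ 0` such that for all `‖y‖ ≥ S₁`:
`‖DG(y) − O‖ ≤ C‖y‖^{−α}`, `‖D²G(y)‖ ≤ C‖y‖^{−α−1}`, `‖G(y) − O y‖ ≤ C‖y‖^{1−α}`,
`‖y‖/4 ≤ ‖G(y)‖ ≤ 3‖y‖` and `‖DG(y)‖ ≤ 2`. In Bartnik's words: the two structures at infinity
differ by a rigid motion `(O, a) ∈ O(n) ⋉ ℝⁿ` up to terms decaying like `r^{1−α}`.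
[cite: Bartnik1986, §3, Cor. 3.2] -/
theorem exists_rotation [FiniteDimensional ℝ E] (h2 : 2 ≤ Module.finrank ℝ E) :
    ∃ (O : E ≃ₗᵢ[ℝ] E) (S₁ C : ℝ), S + 1 ≤ S₁ ∧ 0 ≤ C ∧ ∀ y : E, S₁ ≤ ‖y‖ →
      ‖fderiv ℝ G y - ((O.toContinuousLinearEquiv : E ≃L[ℝ] E) : E →L[ℝ] E)‖ ≤ C * ‖y‖ ^ (-α) ∧
      ‖fderiv ℝ (fderiv ℝ G) y‖ ≤ C * ‖y‖ ^ (-α - 1) ∧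
      ‖G y - O y‖ ≤ C * ‖y‖ ^ (1 - α) ∧
      ‖y‖ / 4 ≤ ‖G y‖ ∧ ‖G y‖ ≤ 3 * ‖y‖ ∧ ‖fderiv ℝ G y‖ ≤ 2 := by
  have hα := hd.α_pos
  have hα1 := hd.α_lt_one
  have hK := hd.K_nonneg
  obtain ⟨S₀, hS₀, htwo⟩ := hd.exists_norm_G_two_sided
  have hS₀1 : 1 ≤ S₀ := by linarith [hd.one_le_S]
  have hS₀0 : 0 < S₀ := by linarith
  -- (1) the second derivative bound beyond `S₀`
  set C₂ : ℝ := 774 * K with hC₂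
  have hC₂0 : 0 ≤ C₂ := by positivity
  have hD2 : ∀ z : E, S₀ ≤ ‖z‖ → ‖fderiv ℝ (fderiv ℝ G) z‖ ≤ C₂ * ‖z‖ ^ (-1 - α) := by
    intro z hz
    rw [show (-1 - α) = (-α - 1) by ring]
    exact hd.norm_fderiv_fderiv_G_le (by linarith) (htwo z hz).1
  have hdiffP : ∀ z : E, S₀ ≤ ‖z‖ → DifferentiableAt ℝ (fderiv ℝ G) z := fun z hz ↦
    ((hd.contDiffAt_G z (by linarith)).fderiv_right (m := 1) (hd.natCast_le_infty 2)).differentiableAt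
      one_ne_zero
  -- (2) the limit `L` of `DG`
  obtain ⟨L, hL⟩ := exists_limit_of_norm_fderiv_le (f := fderiv ℝ G) h2 hS₀0 hα hC₂0 hdiffP hD2
  -- (3) `L` preserves inner products
  have hLinner : ∀ v w : E, ⟪L v, L w⟫ = ⟪v, w⟫ := by
    intro v w
    -- a point of norm `r` on a fixed ray, for every `r ≥ 2 S₀`
    haveI : Nontrivial E := Module.nontrivial_of_finrank_pos (R := ℝ) (by omega)
    obtain ⟨z₀, hz₀⟩ := exists_ne (0 : E)
    have hz₀n : 0 < ‖z₀‖ := norm_pos_iff.2 hz₀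
    set c : ℝ := (C₂ / α * (‖L‖ + 2) + 17 * K) * ‖v‖ * ‖w‖ with hc
    have hest : ∀ r : ℝ, 2 * S₀ ≤ r → |⟪L v, L w⟫ - ⟪v, w⟫| ≤ c * r ^ (-α) := by
      intro r hr
      have hr0 : 0 < r := by linarith
      set y : E := (r / ‖z₀‖) • z₀ with hy
      have hyn : ‖y‖ = r := by
        rw [hy, norm_smul, Real.norm_of_nonneg (by positivity), div_mul_cancel₀ _ hz₀n.ne']
      have hyS : S < ‖y‖ := by rw [hyn]; linarith
      have hyS₀ : S₀ ≤ ‖y‖ := by rw [hyn]; linarith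
      set P := fderiv ℝ G y with hP
      have hPL : ‖P - L‖ ≤ C₂ / α * r ^ (-α) := by rw [← hyn]; exact hL y (by rw [hyn]; exact hr)
      have hPn : ‖P‖ ≤ 2 := hd.norm_fderiv_G_le hyS
      -- `⟪Lv, Lw⟫ − ⟪Pv, Pw⟫`
      have e1 : |⟪L v, L w⟫ - ⟪P v, P w⟫| ≤ C₂ / α * r ^ (-α) * (‖L‖ + 2) * ‖v‖ * ‖w‖ := by
        have hsplit : ⟪L v, L w⟫ - ⟪P v, P w⟫ = ⟪(L - P) v, L w⟫ + ⟪P v, (L - P) w⟫ := by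
          simp only [_root_.sub_apply, inner_sub_left, inner_sub_right]; ring
        rw [hsplit]
        have hLP : ‖L - P‖ ≤ C₂ / α * r ^ (-α) := by rwa [norm_sub_rev] at hPL
        calc |⟪(L - P) v, L w⟫ + ⟪P v, (L - P) w⟫|
            ≤ |⟪(L - P) v, L w⟫| + |⟪P v, (L - P) w⟫| := abs_add_le _ _
          _ ≤ ‖(L - P) v‖ * ‖L w‖ + ‖P v‖ * ‖(L - P) w‖ :=
              add_le_add (abs_real_inner_le_norm _ _) (abs_real_inner_le_norm _ _)
          _ ≤ (‖L - P‖ * ‖v‖) * (‖L‖ * ‖w‖) + (‖P‖ * ‖v‖) * (‖L - P‖ * ‖w‖) := by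
              gcongr <;> exact le_opNorm _ _
          _ ≤ (C₂ / α * r ^ (-α) * ‖v‖) * (‖L‖ * ‖w‖) + (2 * ‖v‖) * (C₂ / α * r ^ (-α) * ‖w‖) := by
              gcongr
          _ = C₂ / α * r ^ (-α) * (‖L‖ + 2) * ‖v‖ * ‖w‖ := by ring
      -- `⟪Pv, Pw⟫ − ⟪v, w⟫`
      have e2 : |⟪P v, P w⟫ - ⟪v, w⟫| ≤ 17 * K * r ^ (-α) * ‖v‖ * ‖w‖ := by
        have h0 := abs_inner_map_map_sub_inner_le (hd.norm_hG_sub_le_half hyS)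
          (hd.norm_h'_sub_le_half hyS) (hd.law y hyS) v w
        refine h0.trans ?_
        have hq : 0 < ‖y‖ / 4 := by rw [hyn]; positivity
        have hGy : ‖h (G y) - innerSL ℝ‖ ≤ K * (4 * r ^ (-α)) := by
          refine (hd.norm_h_sub_le _ (hd.lt_norm_G hyS)).trans
            (mul_le_mul_of_nonneg_left ?_ hK)
          calc ‖G y‖ ^ (-α) ≤ (‖y‖ / 4) ^ (-α) :=
                Real.rpow_le_rpow_of_nonpos hq (htwo y hyS₀).1 (by linarith)
            _ = r ^ (-α) * (4 : ℝ) ^ α := by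
                rw [hyn, Real.div_rpow hr0.le (by norm_num), div_eq_mul_inv,
                  ← Real.rpow_neg (by norm_num), neg_neg]
            _ ≤ r ^ (-α) * (4 : ℝ) ^ (1 : ℝ) :=
                mul_le_mul_of_nonneg_left (Real.rpow_le_rpow_of_exponent_le (by norm_num) hα1.le)
                  (by positivity)
            _ = 4 * r ^ (-α) := by rw [Real.rpow_one]; ring
        have hy' : ‖h' y - innerSL ℝ‖ ≤ K * r ^ (-α) := by rw [← hyn]; exact hd.norm_h'_sub_le y hyS
        have : (4 * ‖h (G y) - innerSL ℝ‖ + ‖h' y - innerSL ℝ‖) * ‖v‖ * ‖w‖ ≤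
            (4 * (K * (4 * r ^ (-α))) + K * r ^ (-α)) * ‖v‖ * ‖w‖ := by gcongr
        refine this.trans (le_of_eq ?_)
        ring
      calc |⟪L v, L w⟫ - ⟪v, w⟫| = |(⟪L v, L w⟫ - ⟪P v, P w⟫) + (⟪P v, P w⟫ - ⟪v, w⟫)| := by
            ring_nf
        _ ≤ |⟪L v, L w⟫ - ⟪P v, P w⟫| + |⟪P v, P w⟫ - ⟪v, w⟫| := abs_add_le _ _
        _ ≤ C₂ / α * r ^ (-α) * (‖L‖ + 2) * ‖v‖ * ‖w‖ + 17 * K * r ^ (-α) * ‖v‖ * ‖w‖ :=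
            add_le_add e1 e2
        _ = c * r ^ (-α) := by rw [hc]; ring
    -- let `r → ∞`
    have hlim : Tendsto (fun r : ℝ ↦ c * r ^ (-α)) atTop (𝓝 0) := by
      simpa using (tendsto_rpow_neg_atTop hα).const_mul c
    have hle : |⟪L v, L w⟫ - ⟪v, w⟫| ≤ 0 :=
      ge_of_tendsto hlim (Filter.eventually_atTop.2 ⟨2 * S₀, fun r hr ↦ hest r hr⟩)
    exact sub_eq_zero.1 (abs_nonpos_iff.1 hle)
  -- (4) the linear isometry `O`
  set Oli : E →ₗᵢ[ℝ] E := LinearMap.isometryOfInner (L : E →ₗ[ℝ] E) hLinner with hOli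
  set O : E ≃ₗᵢ[ℝ] E := Oli.toLinearIsometryEquiv rfl with hO
  have hOapply : ∀ v : E, O v = L v := fun v ↦ rfl
  have hOclm : ((O.toContinuousLinearEquiv : E ≃L[ℝ] E) : E →L[ℝ] E) = L := by
    ext v; exact hOapply v
  -- (5) sublinear growth of `G − O`
  have hS₂ : 0 < 2 * S₀ := by linarith
  have hdiffg : ∀ z : E, 2 * S₀ ≤ ‖z‖ → DifferentiableAt ℝ (fun y ↦ G y - O y) z := fun z hz ↦
    ((hd.contDiffAt_G z (by linarith)).differentiableAt (by simp)).sub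
      (O.toContinuousLinearEquiv : E ≃L[ℝ] E).differentiableAt
  have hfdg : ∀ z : E, 2 * S₀ ≤ ‖z‖ →
      fderiv ℝ (fun y ↦ G y - O y) z = fderiv ℝ G z - L := by
    intro z hz
    have h1 : (fun y ↦ G y - O y) = fun y ↦ G y - (O.toContinuousLinearEquiv : E ≃L[ℝ] E) y := rfl
    rw [h1, fderiv_fun_sub ((hd.contDiffAt_G z (by linarith)).differentiableAt (by simp))
      (O.toContinuousLinearEquiv : E ≃L[ℝ] E).differentiableAt, ContinuousLinearEquiv.fderiv, hOclm]
  obtain ⟨M₃, hM₃⟩ := norm_le_of_norm_fderiv_le_rpow (f := fun y ↦ G y - O y) (α := α)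
    (C := C₂ / α) hS₂ hα1 (by positivity) hdiffg
    (fun z hz ↦ by rw [hfdg z hz]; exact hL z hz)
  -- (6) assemble
  set C : ℝ := max (C₂ / α) (max C₂ (|M₃| + C₂ / α / (1 - α))) with hCdef
  refine ⟨O, 2 * S₀, C, by linarith, le_max_of_le_left (by positivity), fun y hy ↦ ?_⟩
  have hy1 : 1 ≤ ‖y‖ := by linarith
  have hy0 : 0 < ‖y‖ := by linarith
  have hyS : S < ‖y‖ := by linarith
  have hyS₀ : S₀ ≤ ‖y‖ := by linarith
  refine ⟨?_, ?_, ?_, (htwo y hyS₀).1, (htwo y hyS₀).2, hd.norm_fderiv_G_le hyS⟩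
  · rw [hOclm]
    exact (hL y hy).trans (mul_le_mul_of_nonneg_right (le_max_left _ _) (by positivity))
  · calc ‖fderiv ℝ (fderiv ℝ G) y‖ ≤ C₂ * ‖y‖ ^ (-1 - α) := hD2 y hyS₀
      _ = C₂ * ‖y‖ ^ (-α - 1) := by rw [show (-1 - α) = (-α - 1) by ring]
      _ ≤ C * ‖y‖ ^ (-α - 1) :=
          mul_le_mul_of_nonneg_right ((le_max_left _ _).trans (le_max_right _ _)) (by positivity)
  · have h1 := hM₃ y hy
    have hpow : 1 ≤ ‖y‖ ^ (1 - α) := Real.one_le_rpow hy1 (by linarith)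
    calc ‖G y - O y‖ ≤ M₃ + C₂ / α / (1 - α) * ‖y‖ ^ (1 - α) := h1
      _ ≤ |M₃| * ‖y‖ ^ (1 - α) + C₂ / α / (1 - α) * ‖y‖ ^ (1 - α) := by
          gcongr
          calc M₃ ≤ |M₃| := le_abs_self _
            _ = |M₃| * 1 := (mul_one _).symm
            _ ≤ |M₃| * ‖y‖ ^ (1 - α) := by gcongr
      _ = (|M₃| + C₂ / α / (1 - α)) * ‖y‖ ^ (1 - α) := by ring
      _ ≤ C * ‖y‖ ^ (1 - α) :=
          mul_le_mul_of_nonneg_right ((le_max_right _ _).trans (le_max_right _ _)) (by positivity)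

end TransitionDecay

end TransitionRigidity

end Literature.Geometry.Lorentzian

end
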